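import Mathlib.Analysis.Calculus.ParametricIntegral
import Mathlib.Analysis.Complex.CauchyIntegral
import Mathlib.Analysis.SpecialFunctions.Trigonometric.DerivHyp
import Literature.Probability.LatticeModels.DisorderedXYModel
import HarnessLib

/-!
# The McBryan–Spencer complex-rotation bound for the plane rotator (classical XY model) on a
# finite bond system: `⟨cos(θ_x − θ_y)⟩_β ≤ e^{−(φ_x − φ_y)} · exp(β ∑_a (cosh(φ_{tgt a} − φ_{src a}) − 1))`

Topic `Literature/Probability/LatticeModels`. O. A. McBryan, T. Spencer, *On the decay of correlations
in SO(n)-symmetric ferromagnets*, Comm. Math. Phys. **53** (1977) 299–302 [McBryanSpencer1977]: the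
two-point function of the two-dimensional plane rotator decays at least like a power `|x|^{-1/((2π+ε)β)}`
at every temperature. The engine of the proof (ibid.; S. Friedli, Y. Velenik, *Statistical Mechanics of
Lattice Systems* (CUP 2017), Thm. 9.12, display (9.23) [FriedliVelenik2017]) is the **complex rotation**
`θ_j ↦ θ_j + i φ_j` of the angle variables: since the Gibbs weight is an entire periodic function of the
angles, the integral is unchanged, while the observable `e^{i(θ_x − θ_y)}` acquires the factor
`e^{−(φ_x − φ_y)}` and the modulus of the rotated weight of a bond `a` is
`exp(β cosh(φ_{tgt a} − φ_{src a}) cos(θ_{tgt a} − θ_{src a})) ≤ exp(β (cosh(∇φ)_a − 1)) · exp(β cos(∇θ)_a)`.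
This gives, for EVERY real site function `φ` and every `β ≥ 0`, the a-priori bound

  `⟨cos(θ_x − θ_y)⟩_β ≤ exp(−(φ_x − φ_y)) · exp(β ∑_a (cosh(φ_{tgt a} − φ_{src a}) − 1))`     (★)

(`BondSystem.expect_cosDiff_le_exp_cosh`), here for the finite-volume XY model with free boundary
condition on an arbitrary finite bond system `G : BondSystem V ι` (vocabulary of `DisorderedXYModel.lean`:
spins `θ ∈ U(1)^V` with the Haar probability measure `torusHaar V`, weight
`exp(β ∑_a cos(θ_{tgt a} − θ_{src a}))`, expectation `G.expect β 1`). The optimisation of `φ` (a lattice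
Green's-function dipole) that turns (★) into the power law on `(ℤ/Lℤ)²` is the sequel
`PlaneRotatorPowerLawDecay.lean`.

## The proof given here (no Fubini, no contour bookkeeping)

Instead of shifting one angle at a time (Friedli–Velenik Fig. 9.5), we rotate all spins at once by the
COMPLEX "angles" `ζ φ_v`, `ζ ∈ ℂ`: `complexRotationFn ζ = ∫ θ_x θ̄_y e^{iζ(φ_x−φ_y)}
exp((β/2) ∑_a (w_a e^{iζ δ_a} + w̄_a e^{−iζ δ_a})) dθ` with `w_a = θ̄_{src a} θ_{tgt a}`,
`δ_a = φ_{tgt a} − φ_{src a}`. For REAL `ζ = τ` the integrand is the un-rotated one evaluated at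
`θ · (e^{iτφ_v})_v`, so the integral is constant in `τ` by translation invariance of Haar measure
(`complexRotationFn_ofReal`); the integral is an ENTIRE function of `ζ` (differentiation under the
integral sign, `hasDerivAt_integral_of_dominated_loc_of_deriv_le`); hence by the identity theorem it
is constant on `ℂ`, in particular at `ζ = i` (`complexRotationFn_I`), where its modulus is bounded as
in (9.23) (`norm_complexRotationIntegrand_I_le`), while at `ζ = 0` its real part is
`Z · ⟨cos(θ_x − θ_y)⟩` (`complexRotationFn_zero_re`).

## References

* O. A. McBryan, T. Spencer, Comm. Math. Phys. 53 (1977) 299–302 (main theorem and its proof).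
  [McBryanSpencer1977]
* S. Friedli, Y. Velenik, *Statistical Mechanics of Lattice Systems*, CUP 2017, §9.4, Thm. 9.12,
  display (9.23) (pp. 463–465). [FriedliVelenik2017]

Mathlib: `hasDerivAt_integral_of_dominated_loc_of_deriv_le`, `DifferentiableOn.analyticOnNhd`,
`AnalyticOnNhd.eq_of_frequently_eq`, `integral_mul_right_eq_self` (via the tree's
`integral_torusHaar_mul_right`). Not here: infinite volume, boundary conditions, the choice of `φ`.
-/

noncomputable section

open MeasureTheory Finset Filter Complex
open scoped BigOperators ComplexConjugate Topology

namespace Literature.Probability.LatticeModels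

namespace BondSystem

variable {V ι : Type*} (G : BondSystem V ι)

/-! ### Rotation fields and the rotated bond variables -/

section Fields

variable (φ : V → ℝ)

/-- The gradient `δ_a = φ(tgt a) − φ(src a)` of the rotation field `φ` along the bond `a`. [folklore] -/
def bondGrad (a : ι) : ℝ := φ (G.tgt a) - φ (G.src a)

/-- The sitewise rotation `(e^{iτφ_v})_v ∈ U(1)^V` by the real angles `τ φ_v`. [folklore] -/
def twistField (τ : ℝ) : V → Circle := fun v => Circle.exp (τ * φ v)

/-- `I · c · I = −c`. [folklore] -/
private theorem I_mul_ofReal_mul_I (c : ℝ) : I * (c : ℂ) * I = -(c : ℂ) := by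
  rw [mul_right_comm, I_mul_I, neg_one_mul]

/-- The spin at `v` of the rotated configuration, as a complex number: `θ_v e^{iτφ_v}`. [folklore] -/
private theorem coe_mul_twistField (θ : V → Circle) (τ : ℝ) (v : V) :
    (((θ * twistField φ τ) v : Circle) : ℂ) = ((θ v : Circle) : ℂ) * cexp (((τ * φ v : ℝ) : ℂ) * I) := by
  rw [Pi.mul_apply, Circle.coe_mul, twistField, Circle.coe_exp]

/-- The bond variable of the rotated configuration: `w_a(θ e^{iτφ}) = w_a(θ) e^{iτδ_a}`. [folklore] -/
private theorem coe_bondVar_one_mul_twistField (θ : V → Circle) (τ : ℝ) (a : ι) :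
    ((G.bondVar 1 (θ * twistField φ τ) a : Circle) : ℂ) =
      ((G.bondVar 1 θ a : Circle) : ℂ) * cexp (I * ((G.bondGrad φ a : ℝ) : ℂ) * (τ : ℂ)) := by
  have key : cexp (-(((τ * φ (G.src a) : ℝ) : ℂ) * I)) * cexp (((τ * φ (G.tgt a) : ℝ) : ℂ) * I) =
      cexp (I * ((G.bondGrad φ a : ℝ) : ℂ) * (τ : ℂ)) := by
    rw [← Complex.exp_add]; congr 1; unfold bondGrad; push_cast; ring
  simp only [bondVar_one, Circle.coe_mul, Circle.coe_inv_eq_conj, coe_mul_twistField, map_mul,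
    ← Complex.exp_conj, Complex.conj_ofReal, Complex.conj_I, mul_neg]
  linear_combination (conj ((θ (G.src a) : Circle) : ℂ) * ((θ (G.tgt a) : Circle) : ℂ)) * key

end Fields

/-! ### The complex-rotated integrand -/

section Integrand

variable [Fintype ι] (β : ℝ) (φ : V → ℝ) (x y : V)

/-- The exponent of the complex-rotated integrand:
`E(ζ, θ) = iζ(φ_x − φ_y) + (β/2) ∑_a (w_a e^{iζδ_a} + w̄_a e^{−iζδ_a})`, `w_a = θ̄_{src a} θ_{tgt a}`; for
real `ζ = τ` this is `iτ(φ_x−φ_y) + β ∑_a cos(θ_{tgt a} − θ_{src a} + τδ_a)`, for `ζ = i` its real part is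
`−(φ_x−φ_y) + β ∑_a cosh(δ_a) cos(θ_{tgt a} − θ_{src a})` (Friedli–Velenik (9.23)).
[cite: FriedliVelenik2017, Thm 9.12, display (9.23)] -/
def complexRotationExponent (ζ : ℂ) (θ : V → Circle) : ℂ :=
  I * ((φ x - φ y : ℝ) : ℂ) * ζ +
    ((β / 2 : ℝ) : ℂ) * ∑ a, (((G.bondVar 1 θ a : Circle) : ℂ) * cexp (I * ((G.bondGrad φ a : ℝ) : ℂ) * ζ) +
      conj ((G.bondVar 1 θ a : Circle) : ℂ) * cexp (-(I * ((G.bondGrad φ a : ℝ) : ℂ) * ζ)))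

/-- The `ζ`-derivative of the exponent:
`E'(ζ, θ) = i(φ_x − φ_y) + (β/2) ∑_a iδ_a (w_a e^{iζδ_a} − w̄_a e^{−iζδ_a})`. [folklore] -/
def complexRotationExponentDeriv (ζ : ℂ) (θ : V → Circle) : ℂ :=
  I * ((φ x - φ y : ℝ) : ℂ) +
    ((β / 2 : ℝ) : ℂ) * ∑ a, (((G.bondVar 1 θ a : Circle) : ℂ) *
        (cexp (I * ((G.bondGrad φ a : ℝ) : ℂ) * ζ) * (I * ((G.bondGrad φ a : ℝ) : ℂ))) +
      conj ((G.bondVar 1 θ a : Circle) : ℂ) *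
        (cexp (-(I * ((G.bondGrad φ a : ℝ) : ℂ) * ζ)) * (-(I * ((G.bondGrad φ a : ℝ) : ℂ)))))

/-- The complex-rotated integrand `θ_x θ̄_y · exp E(ζ, θ)`: at `ζ = 0` it is
`e^{i(θ_x − θ_y)} · exp(β ∑_a cos(θ_{tgt a} − θ_{src a}))`, and for real `ζ = τ` it is that function
evaluated at the rotated configuration `(θ_v e^{iτφ_v})_v`.
[cite: FriedliVelenik2017, Thm 9.12, display (9.23)] -/
def complexRotationIntegrand (ζ : ℂ) (θ : V → Circle) : ℂ :=
  ((θ x : Circle) : ℂ) * conj ((θ y : Circle) : ℂ) * cexp (G.complexRotationExponent β φ x y ζ θ)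

/-- The `ζ`-derivative of the complex-rotated integrand. [folklore] -/
def complexRotationIntegrandDeriv (ζ : ℂ) (θ : V → Circle) : ℂ :=
  ((θ x : Circle) : ℂ) * conj ((θ y : Circle) : ℂ) *
    (cexp (G.complexRotationExponent β φ x y ζ θ) * G.complexRotationExponentDeriv β φ x y ζ θ)

/-! #### Continuity and differentiability in `ζ` -/

/-- The exponent is jointly continuous in `(ζ, θ)`. [folklore] -/
private theorem continuous_complexRotationExponent :
    Continuous fun p : ℂ × (V → Circle) => G.complexRotationExponent β φ x y p.1 p.2 := by
  unfold complexRotationExponent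
  have hw : ∀ a, Continuous fun p : ℂ × (V → Circle) => ((G.bondVar 1 p.2 a : Circle) : ℂ) := fun a =>
    continuous_subtype_val.comp ((G.continuous_bondVar 1 a).comp continuous_snd)
  fun_prop

/-- The derivative of the exponent is jointly continuous in `(ζ, θ)`. [folklore] -/
private theorem continuous_complexRotationExponentDeriv :
    Continuous fun p : ℂ × (V → Circle) => G.complexRotationExponentDeriv β φ x y p.1 p.2 := by
  unfold complexRotationExponentDeriv
  have hw : ∀ a, Continuous fun p : ℂ × (V → Circle) => ((G.bondVar 1 p.2 a : Circle) : ℂ) := fun a =>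
    continuous_subtype_val.comp ((G.continuous_bondVar 1 a).comp continuous_snd)
  fun_prop

/-- The rotated integrand is jointly continuous in `(ζ, θ)`. [folklore] -/
private theorem continuous_complexRotationIntegrand :
    Continuous fun p : ℂ × (V → Circle) => G.complexRotationIntegrand β φ x y p.1 p.2 := by
  unfold complexRotationIntegrand
  have hx : Continuous fun p : ℂ × (V → Circle) => ((p.2 x : Circle) : ℂ) :=
    continuous_subtype_val.comp ((continuous_apply x).comp continuous_snd)
  have hy : Continuous fun p : ℂ × (V → Circle) => ((p.2 y : Circle) : ℂ) :=
    continuous_subtype_val.comp ((continuous_apply y).comp continuous_snd)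
  have hE := G.continuous_complexRotationExponent β φ x y
  fun_prop

/-- The derivative of the rotated integrand is jointly continuous in `(ζ, θ)`. [folklore] -/
private theorem continuous_complexRotationIntegrandDeriv :
    Continuous fun p : ℂ × (V → Circle) => G.complexRotationIntegrandDeriv β φ x y p.1 p.2 := by
  unfold complexRotationIntegrandDeriv
  have hx : Continuous fun p : ℂ × (V → Circle) => ((p.2 x : Circle) : ℂ) :=
    continuous_subtype_val.comp ((continuous_apply x).comp continuous_snd)
  have hy : Continuous fun p : ℂ × (V → Circle) => ((p.2 y : Circle) : ℂ) :=
    continuous_subtype_val.comp ((continuous_apply y).comp continuous_snd)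
  have hE := G.continuous_complexRotationExponent β φ x y
  have hE' := G.continuous_complexRotationExponentDeriv β φ x y
  fun_prop

/-- `ζ ↦ c ζ` has derivative `c`. [folklore] -/
private theorem hasDerivAt_const_mul (c ζ : ℂ) : HasDerivAt (fun z : ℂ => c * z) c ζ := by
  simpa using (hasDerivAt_id ζ).const_mul c

/-- The exponent is an entire function of `ζ` with the stated derivative. [folklore] -/
private theorem hasDerivAt_complexRotationExponent (θ : V → Circle) (ζ : ℂ) :
    HasDerivAt (fun z => G.complexRotationExponent β φ x y z θ)
      (G.complexRotationExponentDeriv β φ x y ζ θ) ζ := by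
  unfold complexRotationExponent complexRotationExponentDeriv
  refine (hasDerivAt_const_mul _ ζ).add (HasDerivAt.const_mul _ (HasDerivAt.fun_sum fun a _ => ?_))
  refine (HasDerivAt.const_mul _ ?_).add (HasDerivAt.const_mul _ ?_)
  · exact (hasDerivAt_const_mul _ ζ).cexp
  · exact (hasDerivAt_const_mul _ ζ).fun_neg.cexp

/-- The rotated integrand is an entire function of `ζ` with the stated derivative. [folklore] -/
private theorem hasDerivAt_complexRotationIntegrand (θ : V → Circle) (ζ : ℂ) :
    HasDerivAt (fun z => G.complexRotationIntegrand β φ x y z θ)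
      (G.complexRotationIntegrandDeriv β φ x y ζ θ) ζ := by
  unfold complexRotationIntegrand complexRotationIntegrandDeriv
  exact ((G.hasDerivAt_complexRotationExponent β φ x y θ ζ).cexp).const_mul _

/-! #### Real rotations are translations of the torus -/

/-- For real `ζ = τ` the rotated integrand is the un-rotated integrand (`ζ = 0`) of the configuration
rotated by `(e^{iτφ_v})_v`. [cite: FriedliVelenik2017, Thm 9.12, proof (periodicity of the integrand)] -/
theorem complexRotationIntegrand_ofReal (θ : V → Circle) (τ : ℝ) :
    G.complexRotationIntegrand β φ x y (τ : ℂ) θ =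
      G.complexRotationIntegrand β φ x y 0 (θ * twistField φ τ) := by
  have key : cexp (I * ((φ x - φ y : ℝ) : ℂ) * (τ : ℂ)) =
      cexp (((τ * φ x : ℝ) : ℂ) * I) * cexp (-(((τ * φ y : ℝ) : ℂ) * I)) := by
    rw [← Complex.exp_add]; congr 1; push_cast; ring
  unfold complexRotationIntegrand complexRotationExponent
  simp only [coe_bondVar_one_mul_twistField, coe_mul_twistField, map_mul, mul_zero, neg_zero,
    Complex.exp_zero, mul_one, zero_add, ← Complex.exp_conj, Complex.conj_ofReal, Complex.conj_I, mul_neg,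
    neg_mul, Complex.exp_add, key]
  ring

end Integrand

/-! ### The rotated integral as an entire function of `ζ` -/

section Function

variable [Fintype V] [Fintype ι] [MeasurableSpace Circle] [BorelSpace Circle] (β : ℝ) (φ : V → ℝ) (x y : V)

/-- The complex-rotated integral `ζ ↦ ∫ θ_x θ̄_y exp E(ζ, θ) dθ` (Haar probability measure of
`U(1)^V`). [cite: FriedliVelenik2017, Thm 9.12, display (9.23)] -/
def complexRotationFn (ζ : ℂ) : ℂ :=
  ∫ θ, G.complexRotationIntegrand β φ x y ζ θ ∂torusHaar V

/-- **Invariance under real rotations**: for real `τ` the rotated integral equals the un-rotated one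
(translation invariance of the Haar measure of `U(1)^V` under `θ ↦ θ · (e^{iτφ_v})_v`; in the angle
picture: periodicity of the integrand). [cite: FriedliVelenik2017, Thm 9.12, proof (periodicity of the integrand)] -/
theorem complexRotationFn_ofReal (τ : ℝ) :
    G.complexRotationFn β φ x y (τ : ℂ) = G.complexRotationFn β φ x y 0 := by
  unfold complexRotationFn
  simp_rw [complexRotationIntegrand_ofReal]
  exact integral_torusHaar_mul_right (fun θ => G.complexRotationIntegrand β φ x y 0 θ) (twistField φ τ)

/-- **Differentiation under the integral sign**: the rotated integral is complex-differentiable at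
every `ζ₀`, with derivative the integral of the derivative of the integrand (dominated on the unit ball
around `ζ₀` by the maximum of the continuous derivative over the compact set
`closedBall ζ₀ 1 × U(1)^V`). [folklore] -/
private theorem hasDerivAt_complexRotationFn (ζ₀ : ℂ) :
    HasDerivAt (G.complexRotationFn β φ x y)
      (∫ θ, G.complexRotationIntegrandDeriv β φ x y ζ₀ θ ∂torusHaar V) ζ₀ := by
  have hF := G.continuous_complexRotationIntegrand β φ x y
  have hF' := G.continuous_complexRotationIntegrandDeriv β φ x y
  have hFζ : ∀ ζ, Continuous fun θ : V → Circle => G.complexRotationIntegrand β φ x y ζ θ := fun ζ =>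
    hF.comp (continuous_const.prodMk continuous_id)
  have hF'ζ : ∀ ζ, Continuous fun θ : V → Circle => G.complexRotationIntegrandDeriv β φ x y ζ θ := fun ζ =>
    hF'.comp (continuous_const.prodMk continuous_id)
  -- uniform bound of the derivative on `closedBall ζ₀ 1 × univ`
  obtain ⟨C, hC⟩ := ((isCompact_closedBall ζ₀ 1).prod isCompact_univ).exists_bound_of_continuousOn
    hF'.continuousOn
  have h := hasDerivAt_integral_of_dominated_loc_of_deriv_le (μ := torusHaar V)
    (F := fun ζ θ => G.complexRotationIntegrand β φ x y ζ θ)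
    (F' := fun ζ θ => G.complexRotationIntegrandDeriv β φ x y ζ θ) (x₀ := ζ₀)
    (s := Metric.ball ζ₀ 1) (bound := fun _ => C) (Metric.ball_mem_nhds ζ₀ one_pos)
    (Eventually.of_forall fun ζ => (hFζ ζ).aestronglyMeasurable)
    (integrable_torusHaar_of_continuous (hFζ ζ₀)) (hF'ζ ζ₀).aestronglyMeasurable
    (ae_of_all _ fun θ ζ hζ => hC (ζ, θ) (Set.mk_mem_prod (Metric.ball_subset_closedBall hζ) (Set.mem_univ θ)))
    (integrable_const C)
    (ae_of_all _ fun θ ζ _ => G.hasDerivAt_complexRotationIntegrand β φ x y θ ζ)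
  exact h.2

/-- The rotated integral is an entire function. [folklore] -/
private theorem differentiable_complexRotationFn : Differentiable ℂ (G.complexRotationFn β φ x y) :=
  fun ζ => (G.hasDerivAt_complexRotationFn β φ x y ζ).differentiableAt

/-- **The complex rotation `θ_v ↦ θ_v + iφ_v` does not change the integral**: the entire function
`complexRotationFn` is constant on the real axis, hence (identity theorem) constant on `ℂ`; in
particular its value at `ζ = i` equals its value at `ζ = 0`. This is the contour shift of
McBryan–Spencer / Friedli–Velenik Thm 9.12 ("we shift the integration interval from `[-π, π]` to
`[-π, π] + i r_i`"), for all sites simultaneously. [cite: FriedliVelenik2017, Thm 9.12, proof (contour shift, Fig. 9.5)] -/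
theorem complexRotationFn_I : G.complexRotationFn β φ x y I = G.complexRotationFn β φ x y 0 := by
  have hana : AnalyticOnNhd ℂ (G.complexRotationFn β φ x y) Set.univ :=
    (G.differentiable_complexRotationFn β φ x y).differentiableOn.analyticOnNhd isOpen_univ
  have hconst : AnalyticOnNhd ℂ (fun _ : ℂ => G.complexRotationFn β φ x y 0) Set.univ :=
    analyticOnNhd_const
  -- the real sequence `1/(n+1) → 0` inside `ℂ ∖ {0}`
  have ht : Tendsto (fun n : ℕ => (((1 / ((n : ℝ) + 1) : ℝ)) : ℂ)) atTop (𝓝[≠] (0 : ℂ)) := by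
    refine tendsto_nhdsWithin_iff.2 ⟨?_, Eventually.of_forall fun n => ?_⟩
    · have h0 : Tendsto (fun n : ℕ => (((1 / ((n : ℝ) + 1) : ℝ)) : ℂ)) atTop (𝓝 (((0 : ℝ)) : ℂ)) :=
        (Complex.continuous_ofReal.tendsto (0 : ℝ)).comp tendsto_one_div_add_atTop_nhds_zero_nat
      rwa [Complex.ofReal_zero] at h0
    · rw [Set.mem_compl_iff, Set.mem_singleton_iff, ofReal_eq_zero]
      exact (by positivity : (0 : ℝ) < 1 / ((n : ℝ) + 1)).ne'
  have hfreq : ∃ᶠ z in 𝓝[≠] (0 : ℂ), G.complexRotationFn β φ x y z = G.complexRotationFn β φ x y 0 :=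
    ht.frequently (Frequently.of_forall fun n => G.complexRotationFn_ofReal β φ x y _)
  exact congrFun (hana.eq_of_frequently_eq hconst hfreq) I

/-! ### The modulus at `ζ = i` and the value at `ζ = 0` -/

omit [Fintype V] [MeasurableSpace Circle] [BorelSpace Circle] in
/-- The real part of the exponent at `ζ = i`:
`Re E(i, θ) = −(φ_x − φ_y) + β ∑_a cos(θ_{tgt a} − θ_{src a}) cosh(δ_a)` (Friedli–Velenik (9.23):
`|e^{cos(θ_i + ir_i − θ_j − ir_j)}| = e^{cosh(r_i − r_j) cos(θ_i − θ_j)}`).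
[cite: FriedliVelenik2017, Thm 9.12, display before (9.23)] -/
theorem complexRotationExponent_I_re (θ : V → Circle) :
    (G.complexRotationExponent β φ x y I θ).re =
      -(φ x - φ y) + β * ∑ a, ((G.bondVar 1 θ a : Circle) : ℂ).re * Real.cosh (G.bondGrad φ a) := by
  unfold complexRotationExponent
  have hexp : ∀ a, cexp (I * ((G.bondGrad φ a : ℝ) : ℂ) * I) = ((Real.exp (-G.bondGrad φ a) : ℝ) : ℂ) := by
    intro a; rw [I_mul_ofReal_mul_I, Complex.ofReal_exp, Complex.ofReal_neg]
  have hexp' : ∀ a, cexp (-(I * ((G.bondGrad φ a : ℝ) : ℂ) * I)) = ((Real.exp (G.bondGrad φ a) : ℝ) : ℂ) := by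
    intro a; rw [I_mul_ofReal_mul_I, neg_neg, Complex.ofReal_exp]
  simp_rw [hexp, hexp', I_mul_ofReal_mul_I]
  rw [Complex.add_re, Complex.neg_re, Complex.ofReal_re, Complex.re_ofReal_mul, Complex.re_sum]
  congr 1
  rw [show β = β / 2 * 2 by ring, mul_assoc (β / 2), Finset.mul_sum univ (fun a => _) 2]
  congr 1
  · ring
  refine Finset.sum_congr rfl fun a _ => ?_
  rw [Complex.add_re, Complex.mul_re, Complex.mul_re, Complex.ofReal_re, Complex.ofReal_im,
    Complex.ofReal_re, Complex.ofReal_im, Complex.conj_re, Complex.conj_im, Real.cosh_eq]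
  ring

omit [Fintype V] [MeasurableSpace Circle] [BorelSpace Circle] in
/-- The exponent at `ζ = 0` is `β ∑_a cos(θ_{tgt a} − θ_{src a})` (the un-rotated weight).
[folklore] -/
private theorem complexRotationExponent_zero (θ : V → Circle) :
    G.complexRotationExponent β φ x y 0 θ = ((β * G.energy 1 θ : ℝ) : ℂ) := by
  unfold complexRotationExponent energy
  simp only [mul_zero, neg_zero, Complex.exp_zero, mul_one, zero_add, Complex.add_conj]
  push_cast
  rw [Finset.mul_sum, Finset.mul_sum]
  refine Finset.sum_congr rfl fun a _ => ?_
  ring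

omit [Fintype V] [MeasurableSpace Circle] [BorelSpace Circle] in
/-- The un-rotated integrand is `e^{i(θ_x − θ_y)}` times the Gibbs weight. [folklore] -/
private theorem complexRotationIntegrand_zero (θ : V → Circle) :
    G.complexRotationIntegrand β φ x y 0 θ =
      ((θ x : Circle) : ℂ) * conj ((θ y : Circle) : ℂ) * ((G.weight β 1 θ : ℝ) : ℂ) := by
  rw [complexRotationIntegrand, complexRotationExponent_zero, weight, Complex.ofReal_exp]

omit [Fintype V] [MeasurableSpace Circle] [BorelSpace Circle] in
/-- **The modulus of the rotated integrand** (Friedli–Velenik (9.23), last two steps: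
`cosh ≥ 1` and `cos ≤ 1`): for `β ≥ 0`,
`|θ_x θ̄_y exp E(i, θ)| ≤ e^{−(φ_x−φ_y)} · exp(β ∑_a (cosh δ_a − 1)) · exp(β ∑_a cos(θ_{tgt a} − θ_{src a}))`.
[cite: FriedliVelenik2017, Thm 9.12, display (9.23)] -/
theorem norm_complexRotationIntegrand_I_le (hβ : 0 ≤ β) (θ : V → Circle) :
    ‖G.complexRotationIntegrand β φ x y I θ‖ ≤
      Real.exp (-(φ x - φ y)) * Real.exp (β * ∑ a, (Real.cosh (G.bondGrad φ a) - 1)) * G.weight β 1 θ := by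
  rw [complexRotationIntegrand, norm_mul, norm_mul, Complex.norm_conj, Circle.norm_coe, Circle.norm_coe,
    one_mul, one_mul, Complex.norm_exp, complexRotationExponent_I_re, weight, ← Real.exp_add,
    ← Real.exp_add, Real.exp_le_exp, add_assoc, add_le_add_iff_left, ← mul_add, energy,
    ← Finset.sum_add_distrib]
  refine mul_le_mul_of_nonneg_left (Finset.sum_le_sum fun a _ => ?_) hβ
  have hre : ((G.bondVar 1 θ a : Circle) : ℂ).re ≤ 1 :=
    (Complex.re_le_norm _).trans_eq (Circle.norm_coe _)
  have hcosh : 1 ≤ Real.cosh (G.bondGrad φ a) := Real.one_le_cosh _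
  nlinarith [mul_nonneg (sub_nonneg.2 hre) (sub_nonneg.2 hcosh)]

/-- The real part of the un-rotated integral is `Z · ⟨cos(θ_x − θ_y)⟩`, i.e.
`Re ∫ e^{i(θ_x−θ_y)} e^{β ∑ cos} dθ = ∫ cos(θ_x − θ_y) e^{β ∑ cos} dθ`. [folklore] -/
private theorem complexRotationFn_zero_re :
    (G.complexRotationFn β φ x y 0).re = ∫ θ, cosDiff x y θ * G.weight β 1 θ ∂torusHaar V := by
  unfold complexRotationFn
  have hc : Continuous fun θ : V → Circle => G.complexRotationIntegrand β φ x y 0 θ :=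
    (G.continuous_complexRotationIntegrand β φ x y).comp (continuous_const.prodMk continuous_id)
  have h := integral_re (integrable_torusHaar_of_continuous hc)
  simp only [RCLike.re_to_complex] at h
  rw [← h]
  refine integral_congr_ae (ae_of_all _ fun θ => ?_)
  dsimp only
  rw [complexRotationIntegrand_zero, Complex.re_mul_ofReal]
  congr 1
  rw [cosDiff, Complex.mul_re, Complex.mul_re, Complex.conj_re, Complex.conj_im, Complex.conj_re,
    Complex.conj_im]
  ring

/-! ### The McBryan–Spencer a-priori bound -/

/-- **McBryan–Spencer complex-rotation bound** (McBryan–Spencer 1977; Friedli–Velenik 2017,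
Thm 9.12, display (9.23)), finite volume, free boundary condition, arbitrary finite bond system: for
the plane-rotator Gibbs state `⟨·⟩_β ∝ exp(β ∑_a cos(θ_{tgt a} − θ_{src a})) ∏ dθ_v` with `β ≥ 0`, every
real site function `φ` and all sites `x, y`,

  `⟨cos(θ_x − θ_y)⟩_β ≤ exp(−(φ_x − φ_y)) · exp(β ∑_a (cosh(φ_{tgt a} − φ_{src a}) − 1))`.

(The right-hand side is then optimised over `φ`; with a lattice Green's-function dipole on `ℤ²` it
yields the power law `|x − y|^{−1/(2πβ)}` up to constants — the sequel
`PlaneRotatorPowerLawDecay.lean`.) [cite: McBryanSpencer1977, main theorem (proof: complex rotation bound)] -/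
theorem expect_cosDiff_le_exp_cosh (hβ : 0 ≤ β) :
    G.expect β 1 (cosDiff x y) ≤
      Real.exp (-(φ x - φ y)) * Real.exp (β * ∑ a, (Real.cosh (φ (G.tgt a) - φ (G.src a)) - 1)) := by
  have hZ := G.partitionFn_pos β 1
  rw [expect, div_le_iff₀ hZ]
  calc ∫ θ, cosDiff x y θ * G.weight β 1 θ ∂torusHaar V
      = (G.complexRotationFn β φ x y 0).re := (G.complexRotationFn_zero_re β φ x y).symm
    _ = (G.complexRotationFn β φ x y I).re := by rw [complexRotationFn_I]
    _ ≤ ‖G.complexRotationFn β φ x y I‖ := Complex.re_le_norm _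
    _ ≤ ∫ θ, ‖G.complexRotationIntegrand β φ x y I θ‖ ∂torusHaar V := norm_integral_le_integral_norm _
    _ ≤ ∫ θ, Real.exp (-(φ x - φ y)) * Real.exp (β * ∑ a, (Real.cosh (G.bondGrad φ a) - 1)) *
          G.weight β 1 θ ∂torusHaar V :=
        integral_mono_of_nonneg (ae_of_all _ fun _ => norm_nonneg _)
          ((G.integrable_weight β 1).const_mul _)
          (ae_of_all _ fun θ => G.norm_complexRotationIntegrand_I_le β φ x y hβ θ)
    _ = Real.exp (-(φ x - φ y)) * Real.exp (β * ∑ a, (Real.cosh (φ (G.tgt a) - φ (G.src a)) - 1)) *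
          G.partitionFn β 1 := by
        rw [integral_const_mul]; rfl

/-- The same bound for the ABSOLUTE VALUE of the two-point function (the modulus of the rotated
integral bounds `|Re|` directly; no Griffiths inequality is used): for `β ≥ 0`, every `φ` and all
`x, y`, `|⟨cos(θ_x − θ_y)⟩_β| ≤ exp(−(φ_x − φ_y)) · exp(β ∑_a (cosh(φ_{tgt a} − φ_{src a}) − 1))`.
[cite: FriedliVelenik2017, Thm 9.12, display (9.23)] -/
theorem abs_expect_cosDiff_le_exp_cosh (hβ : 0 ≤ β) :
    |G.expect β 1 (cosDiff x y)| ≤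
      Real.exp (-(φ x - φ y)) * Real.exp (β * ∑ a, (Real.cosh (φ (G.tgt a) - φ (G.src a)) - 1)) := by
  have hZ := G.partitionFn_pos β 1
  rw [expect, abs_div, abs_of_pos hZ, div_le_iff₀ hZ]
  calc |∫ θ, cosDiff x y θ * G.weight β 1 θ ∂torusHaar V|
      = |(G.complexRotationFn β φ x y I).re| := by rw [complexRotationFn_I, complexRotationFn_zero_re]
    _ ≤ ‖G.complexRotationFn β φ x y I‖ := Complex.abs_re_le_norm _
    _ ≤ ∫ θ, ‖G.complexRotationIntegrand β φ x y I θ‖ ∂torusHaar V := norm_integral_le_integral_norm _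
    _ ≤ ∫ θ, Real.exp (-(φ x - φ y)) * Real.exp (β * ∑ a, (Real.cosh (G.bondGrad φ a) - 1)) *
          G.weight β 1 θ ∂torusHaar V :=
        integral_mono_of_nonneg (ae_of_all _ fun _ => norm_nonneg _)
          ((G.integrable_weight β 1).const_mul _)
          (ae_of_all _ fun θ => G.norm_complexRotationIntegrand_I_le β φ x y hβ θ)
    _ = Real.exp (-(φ x - φ y)) * Real.exp (β * ∑ a, (Real.cosh (φ (G.tgt a) - φ (G.src a)) - 1)) *
          G.partitionFn β 1 := by
        rw [integral_const_mul]; rfl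

end Function

end BondSystem

end Literature.Probability.LatticeModels
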